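import Summits.BirchSwinnertonDyer.BirchSwinnertonDyer.Theses.CMKolyvaginAtInertTwo
import HarnessLib

/-!
# Route `CMKolyvaginAtInertTwo`: the join `Assembly` (item stmt-BirchSwinnertonDyer-22839)

The route's assembly item
`Summit.BirchSwinnertonDyer.BirchSwinnertonDyer.Theses.CMKolyvaginAtInertTwo.Assembly :=
  CMPrimitiveSupplyAtInertTwo → CMKolyvaginExactAtInertTwo → CMExactDescentAtTwo →
    OffHabitatCMResidualAtTwo → CMRankZeroBSDTriple → EntireLFunctionRat →
    Summit.BirchSwinnertonDyer.WAllCornerFTwo`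
is the route's deciding chain in its BIRTH currency: the present deciding theorem `closes` first derives
the primitive supply `CMPrimitiveSupplyAtInertTwo` and the exact descent `CMExactDescentAtTwo` from
their `…OfFacts` twins and published-input binders and then runs exactly this chain; `Assembly` takes
the two derived items directly, so the remainder of the body of `closes` is inlined here verbatim
(habitat: primitive Kolyvagin system + exactness + descent to the rank-`0` CM triple of a twist; off
the habitat: the residual item). Nothing is asserted: the six items stay hypotheses of `Assembly`
itself; no crux is advanced and BSD is not proved by this.
-/

set_option autoImplicit false
set_option linter.dupNamespace false

namespace Summit.BirchSwinnertonDyer.BirchSwinnertonDyer.Theorems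

open Summit.BirchSwinnertonDyer.BirchSwinnertonDyer.Theses.CMKolyvaginAtInertTwo

/-- **The join of route `CMKolyvaginAtInertTwo` holds**: primitive supply, Kolyvagin exactness, exact
descent, the off-habitat residual, the rank-`0` CM BSD triple and the entire `L`-function give the leaf
`Summit.BirchSwinnertonDyer.WAllCornerFTwo` — the body of the route's deciding theorem `closes` after
its two twin derivations, inlined. [folklore] -/
theorem cmKolyvaginAtInertTwo_assembly_proof :
    Summit.BirchSwinnertonDyer.BirchSwinnertonDyer.Theses.CMKolyvaginAtInertTwo.Assembly := by
  unfold Summit.BirchSwinnertonDyer.BirchSwinnertonDyer.Theses.CMKolyvaginAtInertTwo.Assembly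
  intro hP hX hG hR hBF hL W _ _ hcm hr
  haveI : NeZero (W.conductorNorm ℤ) := ⟨(W.conductorNorm_pos_holds).ne'⟩
  by_cases hH : (Literature.NumberTheory.EllipticCurves.Rank1Residual.CMInert W 2 ∧ W.HasSurjectiveModNGaloisRep (2 : ℤ) ∧
        Odd W.tamagawaProduct ∧
        ∃ Dt : Literature.NumberTheory.EllipticCurves.ModularForms.ModularParametrizationData W (W.conductorNorm ℤ),
          (∀ z ∈ Dt.L.lattice, ∃ w ∈ Literature.NumberTheory.EllipticCurves.ModularForms.periodLattice Dt.f, z = (Dt.c : ℂ) * w) ∧ Odd Dt.c)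
  · obtain ⟨hin, hρ, hT, hopt⟩ := hH
    obtain ⟨K, _, _, hIQ, hodd, h3, hHe, hsq1, hsq2, Dt, β, ι, d₁, hoptDt, hc, hy, M₀, hdiv, hndiv,
      n, d, hn, hKoly, hPn, Wd, _, _, hWd, hcmd, hrd⟩ := hP W hcm hin hρ hr hT hopt
    have hex := hX W hcm hin hρ hT K hIQ hodd h3 hHe hsq1 hsq2 Dt β ι d₁ hy M₀ hdiv hndiv n d hn hKoly hPn
    have hBd : Literature.NumberTheory.EllipticCurves.BSDp Wd 2 :=
      Summit.BirchSwinnertonDyer.Rank1Residual.bsdp_cm_rankZero (p := 2) hBF hL hcmd hrd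
    exact hG W hcm hin hρ hr hT K hIQ hodd h3 hHe Dt hoptDt hc β ι d₁ hy M₀ hdiv hndiv hex Wd hWd hBd
  · exact hR W hcm hr hH

end Summit.BirchSwinnertonDyer.BirchSwinnertonDyer.Theorems
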